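import Summits.AtomisticToContinuum.Crystallization.Theorems.ChartedZeroExcessLayeredLatticeLiouvilleXD

/-!
# Zero-excess layered lattice Liouville — part XE (lens-2 g59, node «SBGlueB» 2/2): COHERENCE ALONG CHAINS AND TEAR-FREE TRANSPORT

Continuation of part XD (same node; memo NODE-g59a-SBGlueB-Design.md §1):

* XE.1 (= XD.6) COHERENCE INTEGRATES ALONG BOND CHAINS.  At a coherence centre (`IsCoherentBy ϑ₁ ω₁ S Ψ K`, part UN) every bond is registered up to
  `(28/25)ω₁ + ϑ₁` (`norm_disp_sub_disp_le_of_coherent`, via part TR `dist_map_le_tilt`); along an `S`-bond chain of `k` bonds the displacement `u = id − Ψ`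
  moves by `≤ k((28/25)ω₁ + ϑ₁)` (`norm_disp_sub_disp_le_of_chain`); with XD.5's chains between the atoms of two index sites this is THE GRADIENT BOUND OF THE
  PULLED-BACK FIELD `‖φ Y − φ X‖ ≤ (6C₁·dist X Y + 8)((28/25)ω₁ + ϑ₁)` (`norm_pullDisp_sub_pullDisp_le`) — the smallness of index bond strains that (I1)
  `PairForceTaylorP` needs (`‖h‖ ≤ 1/4`), obtained WITHOUT «`3C₁ ≤ 4`» and uniformly in the iterate up to the accumulated chart drift.
* XE.2 (= XD.7) TEAR-FREE TRANSPORT.  If the chart difference `lsite' − lsite` is `μ`-Lipschitz on the index lattice (what (RC) `EquilChartStrainP` delivers,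
  summed over the steps), the transported registration distorts model distances by factors `(1 + μ/c)`, `(1 + μ/c')` (`dist_transReg_le`,
  `dist_le_dist_transReg`, through `dist_idxOf_le`); so the global registration's two-sided `4 ↦ 8` tear-freeness (part TB `IsGlobalReg`) yields for every
  iterate EXACTLY the thresholds of (I4ˢ) `TailFluxBSP` — `dist ≤ 4 → Ψ'-dist ≤ 9`, `Ψ'-dist ≤ 3 → dist ≤ 8` — once `μ ≤ min(c/8, c'/3)` (`tearFree_transReg`).
No statement of the column is re-typed.
-/

noncomputable section

open scoped BigOperators InnerProductSpace RealInnerProductSpace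
open Set Function Metric
open Summit.AtomisticToContinuum.Crystallization.Theorems.ChartedPlanarOrderRigidityDoor (E3 IsClean)
open Summit.AtomisticToContinuum.Crystallization.Theorems.ChartedPlanarOrderDensityDichotomy (μS IsSep)
open Summit.AtomisticToContinuum.Crystallization.Theorems.ChartedPlanarOrderCleanScaleP (IsCleanP isCleanP_one_iff)
open Summit.AtomisticToContinuum.Crystallization.Theorems.ChartedPlanarOrderDoorLayered (Layered)

namespace Summit.AtomisticToContinuum.Crystallization.Theorems.ChartedZeroExcessLayeredLatticeLiouville

/-! ### XE.1  Coherence integrates along bond chains: the gradient bound on the index lattice -/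

/-- prefix lengths of a bond chain: `dist (z i) (z 0) ≤ (28/25)·i` for `i ≤ k`. [formal bookkeeping] -/
theorem dist_prefix_le_of_isBondChain {S : Set E3} {x p : E3} {k : ℕ} {z : ℕ → E3} (hz : IsBondChain S x p k z) {i : ℕ} (hi : i ≤ k) :
    dist (z i) x ≤ (i : ℝ) * (28 / 25) := by
  obtain ⟨h0, -, -, hbond⟩ := hz
  have h := dist_le_of_chain (k := i) (z := z) fun j hj => hbond j (lt_of_lt_of_le hj hi)
  rwa [h0] at h

/-- ONE COHERENT BOND: at a coherence centre `x ∈ K` every bond `p − x` is registered up to `(28/25)·ω₁ + ϑ₁` — the displacement `u = id − Ψ` has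
`‖u p − u x‖ ≤ (28/25)ω₁ + ϑ₁` (tilt of the local rotation times the bond length, plus the coherence defect). [this file, g59] -/
theorem norm_disp_sub_disp_le_of_coherent {ϑ₁ ω₁ : ℝ} {S K : Set E3} {Ψ : E3 → E3} (hcoh : IsCoherentBy ϑ₁ ω₁ S Ψ K) (hω : 0 ≤ ω₁)
    {x p : E3} (hx : x ∈ K) (hp : p ∈ S) (hd : dist p x ≤ 28 / 25) :
    ‖(p - Ψ p) - (x - Ψ x)‖ ≤ 28 / 25 * ω₁ + ϑ₁ := by
  obtain ⟨U, -, htilt, hU⟩ := hcoh x hx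
  have h1 : dist (U (p - x)) (Ψ p - Ψ x) ≤ ϑ₁ := hU p hp (by linarith)
  have h2 : dist (p - x) (U (p - x)) ≤ tilt U * ‖p - x‖ := dist_map_le_tilt U (p - x)
  have h3 : ‖p - x‖ ≤ 28 / 25 := by rwa [← dist_eq_norm]
  calc ‖(p - Ψ p) - (x - Ψ x)‖ = dist (p - x) (Ψ p - Ψ x) := by rw [dist_eq_norm]; congr 1; abel
    _ ≤ dist (p - x) (U (p - x)) + dist (U (p - x)) (Ψ p - Ψ x) := dist_triangle _ _ _
    _ ≤ tilt U * ‖p - x‖ + ϑ₁ := add_le_add h2 h1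
    _ ≤ ω₁ * (28 / 25) + ϑ₁ := by
        have := mul_le_mul htilt h3 (norm_nonneg _) hω
        linarith
    _ = 28 / 25 * ω₁ + ϑ₁ := by ring

/-- ★ **COHERENCE INTEGRATES ALONG CHAINS**: along an `S`-bond chain of `k` bonds whose sites (but possibly the last) are coherence centres,
`‖u p − u x‖ ≤ k·((28/25)ω₁ + ϑ₁)`. [this file, g59] -/
theorem norm_disp_sub_disp_le_of_chain {ϑ₁ ω₁ : ℝ} {S K : Set E3} {Ψ : E3 → E3} (hcoh : IsCoherentBy ϑ₁ ω₁ S Ψ K) (hω : 0 ≤ ω₁)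
    {x p : E3} {k : ℕ} {z : ℕ → E3} (hz : IsBondChain S x p k z) (hK : ∀ i, i < k → z i ∈ K) :
    ‖(p - Ψ p) - (x - Ψ x)‖ ≤ (k : ℝ) * (28 / 25 * ω₁ + ϑ₁) := by
  obtain ⟨h0, hk, hmem, hbond⟩ := hz
  have main : ∀ i, i ≤ k → ‖(z i - Ψ (z i)) - (z 0 - Ψ (z 0))‖ ≤ (i : ℝ) * (28 / 25 * ω₁ + ϑ₁) := by
    intro i
    induction i with
    | zero => intro; simp
    | succ i ih =>
      intro hi
      have hi' : i < k := hi
      have hstep := norm_disp_sub_disp_le_of_coherent hcoh hω (hK i hi') (hmem (i + 1) hi) (hbond i hi')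
      calc ‖(z (i + 1) - Ψ (z (i + 1))) - (z 0 - Ψ (z 0))‖
          = ‖((z (i + 1) - Ψ (z (i + 1))) - (z i - Ψ (z i))) + ((z i - Ψ (z i)) - (z 0 - Ψ (z 0)))‖ := by congr 1; abel
        _ ≤ ‖(z (i + 1) - Ψ (z (i + 1))) - (z i - Ψ (z i))‖ + ‖(z i - Ψ (z i)) - (z 0 - Ψ (z 0))‖ := norm_add_le _ _
        _ ≤ (28 / 25 * ω₁ + ϑ₁) + (i : ℝ) * (28 / 25 * ω₁ + ϑ₁) := add_le_add hstep (ih hi'.le)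
        _ = ((i + 1 : ℕ) : ℝ) * (28 / 25 * ω₁ + ϑ₁) := by push_cast; ring
  have h := main k le_rfl
  rwa [hk, h0] at h

/-- dictionary: the pulled-back displacement at `X` is the displacement `u = id − Ψ` of the atom at `X`. [this file, g59] -/
theorem pullDisp_eq_disp_atomOf {S : Set E3} {Ψ : E3 → E3} {a b : E3} {w : ℤ → E3} (hbij : BijOn Ψ S (Layered a b w)) (X : Cell 2 × ℤ) :
    pullDisp S Ψ a b w X.1 X.2 = atomOf S Ψ a b w X - Ψ (atomOf S Ψ a b w X) := by
  rw [pullDisp_eq_atomOf_sub, apply_atomOf hbij]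

/-- ★ **THE GRADIENT BOUND ON THE INDEX LATTICE**: for a bijective bond isomorphism onto a clean `C₁`-tame crystal, coherent with defect `ϑ₁` and tilt `ω₁` on
a set `K` containing the `(28/25)(6C₁·dist X Y + 8)`-neighbourhood (in `S`) of the atom at `X`, the pulled-back displacement has
`‖φ Y − φ X‖ ≤ (6C₁·dist X Y + 8)·((28/25)ω₁ + ϑ₁)` — small bond strains of the index field from coherence, WITHOUT «`3C₁ ≤ 4`». [this file, g59] -/
theorem norm_pullDisp_sub_pullDisp_le {S K : Set E3} {Ψ : E3 → E3} {a b : E3} {w : ℤ → E3} {C₁ ϑ₁ ω₁ : ℝ}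
    (hbij : BijOn Ψ S (Layered a b w)) (hiso : IsBondIso S Ψ) (hH : IsClean (μS (Layered a b w))) (hT : IsTameIndexing C₁ a b w)
    (hcoh : IsCoherentBy ϑ₁ ω₁ S Ψ K) (hω : 0 ≤ ω₁) (hϑ : 0 ≤ ϑ₁) (X Y : Cell 2 × ℤ)
    (hK : S ∩ closedBall (atomOf S Ψ a b w X) (28 / 25 * (6 * C₁ * dist X Y + 8)) ⊆ K) :
    ‖pullDisp S Ψ a b w Y.1 Y.2 - pullDisp S Ψ a b w X.1 X.2‖ ≤ (6 * C₁ * dist X Y + 8) * (28 / 25 * ω₁ + ϑ₁) := by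
  obtain ⟨k, z, hk, hz⟩ := exists_atom_chain hbij hiso hH hT X Y
  have hKz : ∀ i, i < k → z i ∈ K := fun i hi =>
    hK ⟨hz.2.2.1 i hi.le, mem_closedBall.2 (((dist_prefix_le_of_isBondChain hz hi.le).trans
      (mul_le_mul_of_nonneg_right (show (i : ℝ) ≤ k by exact_mod_cast hi.le) (by norm_num))).trans (by linarith))⟩
  have h := norm_disp_sub_disp_le_of_chain hcoh hω hz hKz
  rw [pullDisp_eq_disp_atomOf hbij, pullDisp_eq_disp_atomOf hbij]
  have hB : 0 ≤ 28 / 25 * ω₁ + ϑ₁ := by positivity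
  exact h.trans (mul_le_mul_of_nonneg_right hk hB)

/-! ### XE.2  Tear-free bounds transport to the re-charted registration -/

/-- the index map contracts model distances by the co-Lipschitz constant: `dist (I p) (I q) ≤ dist (Ψ p) (Ψ q) / c`. [this file, g59] -/
theorem dist_idxOf_le {S : Set E3} {Ψ : E3 → E3} {a b : E3} {w : ℤ → E3} {c : ℝ} (hbij : BijOn Ψ S (Layered a b w))
    (hc : 0 < c) (hcr : IsLayeredCrystal c a b w) {p q : E3} (hp : p ∈ S) (hq : q ∈ S) :
    dist (idxOf a b w (Ψ p)) (idxOf a b w (Ψ q)) ≤ dist (Ψ p) (Ψ q) / c := by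
  rw [le_div_iff₀ hc]
  have h := hcr (idxOf a b w (Ψ p)) (idxOf a b w (Ψ q))
  rw [lsite_idxOf_apply hbij hp, lsite_idxOf_apply hbij hq, ← dist_eq_norm] at h
  linarith

/-- ★ FORWARD TRANSPORT: if the chart difference `lsite' − lsite` is `μ`-Lipschitz on the index lattice, then
`dist (Ψ' p) (Ψ' q) ≤ (1 + μ/c)·dist (Ψ p) (Ψ q)` on `S` — so `4 ↦ 8` tear-freeness of `Ψ` gives `4 ↦ 9` for `Ψ'` once `μ ≤ c/8`
(the thresholds of (I4ˢ) `TailFluxBSP`). [this file, g59] -/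
theorem dist_transReg_le {S : Set E3} {Ψ : E3 → E3} {a b a' b' : E3} {w w' : ℤ → E3} {c μ : ℝ} (hbij : BijOn Ψ S (Layered a b w))
    (hc : 0 < c) (hcr : IsLayeredCrystal c a b w) (hD : IsIdxLipschitz μ (fun γ m => lsite a' b' w' γ m - lsite a b w γ m)) (hμ : 0 ≤ μ)
    {p q : E3} (hp : p ∈ S) (hq : q ∈ S) :
    dist (transReg Ψ a b w a' b' w' p) (transReg Ψ a b w a' b' w' q) ≤ (1 + μ / c) * dist (Ψ p) (Ψ q) := by
  have h1 := hD (idxOf a b w (Ψ q)) (idxOf a b w (Ψ p))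
  have h2 := dist_idxOf_le hbij hc hcr hq hp
  rw [dist_comm (Ψ q)] at h2
  have hkey : transReg Ψ a b w a' b' w' p - transReg Ψ a b w a' b' w' q =
      (Ψ p - Ψ q) + ((lsite a' b' w' (idxOf a b w (Ψ p)).1 (idxOf a b w (Ψ p)).2 - lsite a b w (idxOf a b w (Ψ p)).1 (idxOf a b w (Ψ p)).2) -
        (lsite a' b' w' (idxOf a b w (Ψ q)).1 (idxOf a b w (Ψ q)).2 - lsite a b w (idxOf a b w (Ψ q)).1 (idxOf a b w (Ψ q)).2)) := by
    rw [← transReg_sub_self (a' := a') (b' := b') (w' := w') hbij hp, ← transReg_sub_self (a' := a') (b' := b') (w' := w') hbij hq]; abel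
  calc dist (transReg Ψ a b w a' b' w' p) (transReg Ψ a b w a' b' w' q)
      = ‖transReg Ψ a b w a' b' w' p - transReg Ψ a b w a' b' w' q‖ := dist_eq_norm _ _
    _ ≤ ‖Ψ p - Ψ q‖ + μ * dist (idxOf a b w (Ψ q)) (idxOf a b w (Ψ p)) := by
        rw [hkey]; exact (norm_add_le _ _).trans (add_le_add le_rfl h1)
    _ ≤ dist (Ψ p) (Ψ q) + μ * (dist (Ψ p) (Ψ q) / c) := by
        rw [← dist_eq_norm]; exact add_le_add le_rfl (mul_le_mul_of_nonneg_left h2 hμ)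
    _ = (1 + μ / c) * dist (Ψ p) (Ψ q) := by ring

/-- ★ BACKWARD TRANSPORT: `dist (Ψ p) (Ψ q) ≤ (1 + μ/c')·dist (Ψ' p) (Ψ' q)` on `S` (co-Lipschitz constant of the NEW chart) — so `Ψ'`-distance `≤ 3`
gives `Ψ`-distance `≤ 4` once `μ ≤ c'/3`, and then `8 ← 4` tear-freeness of `Ψ` gives `dist p q ≤ 8`. [this file, g59] -/
theorem dist_le_dist_transReg {S : Set E3} {Ψ : E3 → E3} {a b a' b' : E3} {w w' : ℤ → E3} {c' μ : ℝ} (hbij : BijOn Ψ S (Layered a b w))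
    (hc' : 0 < c') (hcr' : IsLayeredCrystal c' a' b' w') (hD : IsIdxLipschitz μ (fun γ m => lsite a' b' w' γ m - lsite a b w γ m)) (hμ : 0 ≤ μ)
    {p q : E3} (hp : p ∈ S) (hq : q ∈ S) :
    dist (Ψ p) (Ψ q) ≤ (1 + μ / c') * dist (transReg Ψ a b w a' b' w' p) (transReg Ψ a b w a' b' w' q) := by
  have h1 := hD (idxOf a b w (Ψ q)) (idxOf a b w (Ψ p))
  have h2 : dist (idxOf a b w (Ψ q)) (idxOf a b w (Ψ p)) ≤ dist (transReg Ψ a b w a' b' w' p) (transReg Ψ a b w a' b' w' q) / c' := by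
    rw [le_div_iff₀ hc']
    have h := hcr' (idxOf a b w (Ψ p)) (idxOf a b w (Ψ q))
    have h' : ‖lsite a' b' w' (idxOf a b w (Ψ p)).1 (idxOf a b w (Ψ p)).2 - lsite a' b' w' (idxOf a b w (Ψ q)).1 (idxOf a b w (Ψ q)).2‖ =
        dist (transReg Ψ a b w a' b' w' p) (transReg Ψ a b w a' b' w' q) := by rw [dist_eq_norm]; rfl
    rw [h', dist_comm] at h
    linarith
  have hkey : Ψ p - Ψ q = (transReg Ψ a b w a' b' w' p - transReg Ψ a b w a' b' w' q) -
      ((lsite a' b' w' (idxOf a b w (Ψ p)).1 (idxOf a b w (Ψ p)).2 - lsite a b w (idxOf a b w (Ψ p)).1 (idxOf a b w (Ψ p)).2) -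
        (lsite a' b' w' (idxOf a b w (Ψ q)).1 (idxOf a b w (Ψ q)).2 - lsite a b w (idxOf a b w (Ψ q)).1 (idxOf a b w (Ψ q)).2)) := by
    rw [← transReg_sub_self (a' := a') (b' := b') (w' := w') hbij hp, ← transReg_sub_self (a' := a') (b' := b') (w' := w') hbij hq]; abel
  calc dist (Ψ p) (Ψ q) = ‖Ψ p - Ψ q‖ := dist_eq_norm _ _
    _ ≤ ‖transReg Ψ a b w a' b' w' p - transReg Ψ a b w a' b' w' q‖ + μ * dist (idxOf a b w (Ψ q)) (idxOf a b w (Ψ p)) := by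
        rw [hkey]; exact (norm_sub_le _ _).trans (add_le_add le_rfl h1)
    _ ≤ dist (transReg Ψ a b w a' b' w' p) (transReg Ψ a b w a' b' w' q) +
          μ * (dist (transReg Ψ a b w a' b' w' p) (transReg Ψ a b w a' b' w' q) / c') := by
        rw [← dist_eq_norm]; exact add_le_add le_rfl (mul_le_mul_of_nonneg_left h2 hμ)
    _ = (1 + μ / c') * dist (transReg Ψ a b w a' b' w' p) (transReg Ψ a b w a' b' w' q) := by ring

/-- ★ **(I4ˢ)'s TEAR-FREE HYPOTHESES FOR A RE-CHARTED ITERATE**: from the global registration's two-sided `4 ↦ 8` tear-freeness (part TB `IsGlobalReg`) and an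
accumulated chart drift `μ ≤ min(c/8, c'/3)` on the index lattice, the transported registration satisfies EXACTLY the thresholds of `TailFluxBSP`:
`dist ≤ 4 → Ψ'-dist ≤ 9` and `Ψ'-dist ≤ 3 → dist ≤ 8`. [this file, g59] -/
theorem tearFree_transReg {S : Set E3} {Ψ : E3 → E3} {a b a' b' : E3} {w w' : ℤ → E3} {c c' μ : ℝ} (hbij : BijOn Ψ S (Layered a b w))
    (hc : 0 < c) (hcr : IsLayeredCrystal c a b w) (hc' : 0 < c') (hcr' : IsLayeredCrystal c' a' b' w')
    (hD : IsIdxLipschitz μ (fun γ m => lsite a' b' w' γ m - lsite a b w γ m)) (hμ : 0 ≤ μ) (hμc : μ ≤ c / 8) (hμc' : μ ≤ c' / 3)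
    (hfwd : ∀ x ∈ S, ∀ p ∈ S, dist p x ≤ 4 → dist (Ψ p) (Ψ x) ≤ 8) (hbwd : ∀ x ∈ S, ∀ p ∈ S, dist (Ψ p) (Ψ x) ≤ 4 → dist p x ≤ 8) :
    (∀ x ∈ S, ∀ p ∈ S, dist p x ≤ 4 → dist (transReg Ψ a b w a' b' w' p) (transReg Ψ a b w a' b' w' x) ≤ 9) ∧
      (∀ x ∈ S, ∀ p ∈ S, dist (transReg Ψ a b w a' b' w' p) (transReg Ψ a b w a' b' w' x) ≤ 3 → dist p x ≤ 8) := by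
  refine ⟨fun x hx p hp hd => ?_, fun x hx p hp hd => hbwd x hx p hp ?_⟩
  · have h1 := dist_transReg_le (a' := a') (b' := b') (w' := w') hbij hc hcr hD hμ hp hx
    have h2 := hfwd x hx p hp hd
    have h3 : μ / c ≤ 1 / 8 := by rw [div_le_iff₀ hc]; linarith
    have h4 : (1 + μ / c) * dist (Ψ p) (Ψ x) ≤ (1 + 1 / 8) * 8 :=
      mul_le_mul (by linarith) h2 dist_nonneg (by positivity)
    linarith
  · have h1 := dist_le_dist_transReg (a' := a') (b' := b') (w' := w') hbij hc' hcr' hD hμ hp hx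
    have h3 : μ / c' ≤ 1 / 3 := by rw [div_le_iff₀ hc']; linarith
    have h4 : (1 + μ / c') * dist (transReg Ψ a b w a' b' w' p) (transReg Ψ a b w a' b' w' x) ≤ (1 + 1 / 3) * 3 :=
      mul_le_mul (by linarith) hd dist_nonneg (by positivity)
    linarith

end Summit.AtomisticToContinuum.Crystallization.Theorems.ChartedZeroExcessLayeredLatticeLiouville

end
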